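import Summits.QuantumFields.QCD.Theorems.SpectralDefectExtinctionTipNoBindingStubPositivity
import Literature.Barriers.QuantumFields.WilsonDeterminantMassSplitting
import Literature.MathematicalPhysics.QuantumFieldTheory.QCDPhaseQuenched
import Mathlib.Analysis.CStarAlgebra.ContinuousFunctionalCalculus.Order
import Mathlib.Analysis.CStarAlgebra.Matrix
import Mathlib.Analysis.Matrix.Order
import HarnessLib

/-!
# Crux `ExtinctionBuildsQCD` (stmt-QuantumFields-18064), line `determinant-tilt`, stub W `stub_localHaarWegnerWide`:
# the mass-range extension `[−1,0] → [−1,1]` is free (helper, `--supports`, leafhand 2026-08-30)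

W = crux 8966's local Haar–Wegner lemma (Hölder form, large tori) with bare masses in `[−1,1]` instead of 8966's `[−1,0]`;
leads a2/c6 booked W as `blocked-on 8966 + mass-range extension`.  The extension is discharged here:
`localTrace_le_massZero` — for `m₀ ≥ 0`, `ε > 0` and EVERY gauge field, `t_x(U; m₀, ε) ≤ t_x(U; 0, √(m₀²+ε²))`
(`Im((H − iε)⁻¹)_{ii} = ε((H²+ε²)⁻¹)_{ii}`; `H_m² = D_mᴴD_m`, `D_m = D_0 + m`, `D_mᴴD_m − D_0ᴴD_0 − m² = m(D_0 + D_0ᴴ) ≥ 0`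
by the landed `TipNoBinding…stub_positivity`; Loewner antitonicity of the inverse, `CStarAlgebra.ringInverse_le_ringInverse`);
`stub_localHaarWegnerWide_of_nonposMass` — W's registered conclusion (verbatim) from the same statement on `[−1,0]`
(constant `C + 12`); `stub_localHaarWegnerWide_of_localHaarWegnerHolder` — W (verbatim) from VERBATIM the hypothesis
`hloc` of the landed `WegnerEstimate.ResolventCell.wegnerEstimateHolder_of_localHaarWegnerHolder` (p147521; `L ≥ 2`,
masses `[−1,0]`).  So W is EXACTLY 8966's registered Hölder input; small positive bare mass is never worse than mass `0`
at scale `√(m₀²+ε²)` (the a2-c1 `disprover-wanted` target "W at m₀ ∈ (0, ε]" is void).  The needed slices of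
`stub_localTraceRegular` (p88424) are re-proved (`massWide_localTrace_continuous/_mem`; that module has no hub olean today).
Honest: finite-dimensional linear algebra; W itself stays OPEN (`blocked-on: stmt-QuantumFields-8966`); the crux, QCD and the
Yang–Mills gap are NOT proved.  Sources: Wegner, Z. Phys. B 44 (1981) 9; Montvay–Münster (1994) §4.1, §7.4; Horn–Johnson §7.7.
-/

noncomputable section

namespace Summit.QuantumFields.QCD.Cruxes.ExtinctionBuildsQCD.DeterminantTilt

open scoped BigOperators Matrix ComplexOrder MatrixOrder Matrix.Norms.L2Operator
open MeasureTheory Matrix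
open Literature.MathematicalPhysics.QuantumLattice Literature.MathematicalPhysics.QuantumFieldTheory
  Literature.Probability.LatticeModels
open Literature.Barriers.QuantumFields (isHermitian_gammaFive_mul_wilsonDirac wilsonDirac_add_mass)
open Summit.QuantumFields.QCD.Cruxes.TipNoBinding.PositivityNoLeakSpread (stub_positivity)

section MatrixLemmas

variable {n : Type*} [Fintype n] [DecidableEq n]

/-- Loewner antitonicity of the inverse on positive definite complex matrices (any finite index type),
`0 < C ≤ D ⇒ D⁻¹ ≤ C⁻¹` (cf. the tree's `Literature.Analysis.Complex.inv_le_inv_of_posDef` for `Fin n`). -/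
theorem massWide_inv_antitone {C D : Matrix n n ℂ} (hC : C.PosDef) (hCD : C ≤ D) : D⁻¹ ≤ C⁻¹ := by
  letI : CStarAlgebra (Matrix n n ℂ) := {}
  rw [Matrix.nonsing_inv_eq_ringInverse, Matrix.nonsing_inv_eq_ringInverse]
  exact CStarAlgebra.ringInverse_le_ringInverse hCD (Matrix.isStrictlyPositive_iff_posDef.mpr hC)

omit [Fintype n] [DecidableEq n] in
/-- Diagonal entries are monotone for the Loewner order (real parts): `A ≤ B ⇒ Re A_{ii} ≤ Re B_{ii}`. -/
theorem massWide_re_apply_self_le_of_le {A B : Matrix n n ℂ} (h : A ≤ B) (i : n) :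
    (A i i).re ≤ (B i i).re := by
  have h0 : (0 : ℂ) ≤ (B - A) i i := (show (B - A).PosSemidef from h).diag_nonneg
  have h1 := (Complex.le_def.mp h0).1
  simp only [Matrix.sub_apply, Complex.zero_re, Complex.sub_re] at h1
  linarith

/-- `H·H + c·1` is positive definite for Hermitian `H` and real `c > 0`. -/
theorem massWide_posDef_mul_self_add {H : Matrix n n ℂ} (hH : H.IsHermitian) {c : ℝ} (hc : 0 < c) :
    (H * H + ((c : ℝ) : ℂ) • (1 : Matrix n n ℂ)).PosDef := by
  have h1 : (H * H).PosSemidef := by simpa only [hH.eq] using posSemidef_conjTranspose_mul_self H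
  have h2 : (((c : ℝ) : ℂ) • (1 : Matrix n n ℂ)).PosDef := by
    rw [smul_one_eq_diagonal]
    exact posDef_diagonal_iff.mpr fun _ => Complex.zero_lt_real.mpr hc
  exact Matrix.PosDef.posSemidef_add h1 h2

/-- `(H − iε)(H + iε) = H·H + ε²·1` for real `ε`. -/
theorem massWide_resolvent_mul_conj (H : Matrix n n ℂ) (ε : ℝ) :
    (H - ((ε : ℂ) * Complex.I) • (1 : Matrix n n ℂ)) * (H + ((ε : ℂ) * Complex.I) • (1 : Matrix n n ℂ)) =
      H * H + (((ε ^ 2 : ℝ)) : ℂ) • (1 : Matrix n n ℂ) := by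
  have ha : ((ε : ℂ) * Complex.I) * ((ε : ℂ) * Complex.I) = -((((ε ^ 2 : ℝ)) : ℂ)) := by
    have hI : Complex.I * Complex.I = -1 := Complex.I_mul_I
    push_cast
    linear_combination ((ε : ℂ)) ^ 2 * hI
  simp only [Matrix.sub_mul, Matrix.mul_add, Matrix.mul_smul, Matrix.mul_one, Matrix.smul_mul,
    Matrix.one_mul, smul_sub, smul_smul, ha, neg_smul]
  abel

/-- **Imaginary part of a diagonal resolvent entry**: for Hermitian `H`, `ε > 0`:
`Im((H − iε)⁻¹)_{ii} = ε·Re((H·H + ε²)⁻¹)_{ii}` (`(H − iε)(H + iε) = H² + ε²`, `H(H²+ε²)⁻¹` Hermitian). [Wegner 1981] -/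
theorem massWide_im_resolvent_apply_self {H : Matrix n n ℂ} (hH : H.IsHermitian) {ε : ℝ} (hε : 0 < ε)
    (i : n) :
    ((H - ((ε : ℂ) * Complex.I) • (1 : Matrix n n ℂ))⁻¹ i i).im =
      ε * ((H * H + (((ε ^ 2 : ℝ)) : ℂ) • (1 : Matrix n n ℂ))⁻¹ i i).re := by
  set Q : Matrix n n ℂ := H * H + (((ε ^ 2 : ℝ)) : ℂ) • (1 : Matrix n n ℂ) with hQ
  have hQpd : Q.PosDef := massWide_posDef_mul_self_add hH (by positivity)
  have hQdet : IsUnit Q.det := (Matrix.isUnit_iff_isUnit_det _).mp hQpd.isUnit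
  set K : Matrix n n ℂ := Q⁻¹ with hK
  have hQK : Q * K = 1 := Matrix.mul_nonsing_inv Q hQdet
  have hKQ : K * Q = 1 := Matrix.nonsing_inv_mul Q hQdet
  have hinv : (H - ((ε : ℂ) * Complex.I) • (1 : Matrix n n ℂ))⁻¹ =
      (H + ((ε : ℂ) * Complex.I) • (1 : Matrix n n ℂ)) * K := by
    refine Matrix.inv_eq_right_inv ?_
    rw [← Matrix.mul_assoc, massWide_resolvent_mul_conj, ← hQ, hQK]
  have hHQ : H * Q = Q * H := by
    simp only [hQ, Matrix.mul_add, Matrix.add_mul, Matrix.mul_smul, Matrix.smul_mul, Matrix.mul_one,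
      Matrix.one_mul, Matrix.mul_assoc]
  have hHK : H * K = K * H := by
    calc H * K = (K * Q) * H * K := by rw [hKQ, Matrix.one_mul]
      _ = K * (H * Q) * K := by rw [Matrix.mul_assoc K Q H, hHQ]
      _ = K * H := by rw [Matrix.mul_assoc K (H * Q) K, Matrix.mul_assoc H Q K, hQK, Matrix.mul_one]
  have hKherm : K.IsHermitian := hQpd.isHermitian.inv
  have hHKherm : (H * K).IsHermitian := (hH.commute_iff hKherm).mp hHK
  have h1 : ((H * K) i i).im = 0 := by
    have h := hHKherm.apply i i
    rw [Complex.star_def] at h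
    exact Complex.conj_eq_iff_im.mp h
  rw [hinv, Matrix.add_mul, Matrix.smul_mul, Matrix.one_mul, Matrix.add_apply, Matrix.smul_apply,
    Complex.add_im, smul_eq_mul, h1, zero_add, Complex.mul_im]
  simp only [Complex.mul_re, Complex.mul_im, Complex.ofReal_re, Complex.ofReal_im, Complex.I_re,
    Complex.I_im, mul_zero, mul_one, zero_mul, sub_zero, add_zero, zero_add]

/-- Diagonal entries of the inverse of a positive definite matrix have non-negative real part. -/
theorem massWide_re_inv_apply_self_nonneg {Q : Matrix n n ℂ} (hQ : Q.PosDef) (i : n) :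
    0 ≤ (Q⁻¹ i i).re := by
  have h0 : (0 : ℂ) ≤ Q⁻¹ i i := hQ.inv.posSemidef.diag_nonneg
  have h1 := (Complex.le_def.mp h0).1
  simpa using h1

/-- For Hermitian `H` and `ε > 0`, `det(H − iε) ≠ 0` (`(H − iε)(H + iε) = H² + ε²` is positive definite). -/
theorem massWide_det_resolvent_ne_zero {H : Matrix n n ℂ} (hH : H.IsHermitian) {ε : ℝ} (hε : 0 < ε) :
    (H - ((ε : ℂ) * Complex.I) • (1 : Matrix n n ℂ)).det ≠ 0 := by
  have hQdet : (H * H + (((ε ^ 2 : ℝ)) : ℂ) • (1 : Matrix n n ℂ)).det ≠ 0 :=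
    ((Matrix.isUnit_iff_isUnit_det _).mp (massWide_posDef_mul_self_add hH (by positivity)).isUnit).ne_zero
  intro h0
  apply hQdet
  rw [← massWide_resolvent_mul_conj H ε, det_mul, h0, zero_mul]

/-- For Hermitian `H`, `ε > 0`: `0 ≤ Im((H − iε)⁻¹)_{ii} ≤ 1/ε` (`= ε((H²+ε²)⁻¹)_{ii}`, `ε²·1 ≤ H² + ε²`). [Wegner 1981] -/
theorem massWide_im_resolvent_apply_self_mem {H : Matrix n n ℂ} (hH : H.IsHermitian) {ε : ℝ} (hε : 0 < ε)
    (i : n) :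
    0 ≤ ((H - ((ε : ℂ) * Complex.I) • (1 : Matrix n n ℂ))⁻¹ i i).im ∧
      ((H - ((ε : ℂ) * Complex.I) • (1 : Matrix n n ℂ))⁻¹ i i).im ≤ 1 / ε := by
  rw [massWide_im_resolvent_apply_self hH hε i]
  have hQpd : (H * H + (((ε ^ 2 : ℝ)) : ℂ) • (1 : Matrix n n ℂ)).PosDef :=
    massWide_posDef_mul_self_add hH (by positivity)
  have h0 := massWide_re_inv_apply_self_nonneg hQpd i
  refine ⟨mul_nonneg hε.le h0, ?_⟩
  have hC : ((((ε ^ 2 : ℝ)) : ℂ) • (1 : Matrix n n ℂ)).PosDef := by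
    rw [smul_one_eq_diagonal]
    exact posDef_diagonal_iff.mpr fun _ => Complex.zero_lt_real.mpr (by positivity)
  have hle : (((ε ^ 2 : ℝ)) : ℂ) • (1 : Matrix n n ℂ) ≤ H * H + (((ε ^ 2 : ℝ)) : ℂ) • (1 : Matrix n n ℂ) := by
    rw [Matrix.le_iff, add_sub_cancel_right]
    simpa only [hH.eq] using posSemidef_conjTranspose_mul_self H
  have hinv := massWide_re_apply_self_le_of_le (massWide_inv_antitone hC hle) i
  have hCinv : ((((ε ^ 2 : ℝ)) : ℂ) • (1 : Matrix n n ℂ))⁻¹ = ((((ε ^ 2)⁻¹ : ℝ)) : ℂ) • (1 : Matrix n n ℂ) := by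
    refine Matrix.inv_eq_right_inv ?_
    rw [Matrix.smul_mul, Matrix.one_mul, smul_smul, ← Complex.ofReal_mul,
      mul_inv_cancel₀ (by positivity : (ε ^ 2 : ℝ) ≠ 0), Complex.ofReal_one, one_smul]
  rw [hCinv, Matrix.smul_apply, Matrix.one_apply_eq, smul_eq_mul, mul_one, Complex.ofReal_re] at hinv
  calc ε * ((H * H + (((ε ^ 2 : ℝ)) : ℂ) • (1 : Matrix n n ℂ))⁻¹ i i).re ≤ ε * (ε ^ 2)⁻¹ :=
        mul_le_mul_of_nonneg_left hinv hε.le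
    _ = 1 / ε := by field_simp

end MatrixLemmas

section Wilson

variable {L : ℕ} [NeZero L]

/-- `(Γ₅D)·(Γ₅D) = Dᴴ·D` for the Hermitian Wilson operator `Γ₅D_W(U,m,1)` (`γ₅`-hermiticity
`Γ₅ D_W Γ₅ = D_Wᴴ`, tree `wilsonDirac_gammaFive_hermitian_holds`). [Montvay–Münster 1994 (4.35)] -/
theorem massWide_hermitianWilson_mul_self (U : GaugeConfig 4 L SU3) (m : ℝ) :
    (spinorLift gammaFive * wilsonDirac (fundamentalRep (Fin 3)) U m 1) *
        (spinorLift gammaFive * wilsonDirac (fundamentalRep (Fin 3)) U m 1) =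
      (wilsonDirac (fundamentalRep (Fin 3)) U m 1)ᴴ * wilsonDirac (fundamentalRep (Fin 3)) U m 1 := by
  rw [← wilsonDirac_gammaFive_hermitian_holds (fundamentalRep (Fin 3)) fundamentalRep_mem_unitaryGroup U m 1]
  simp only [Matrix.mul_assoc]

/-- **Loewner comparison across the bare mass**: for `m ≥ 0` and real `c`,
`(Γ₅D_W(0))² + (m² + c)·1 ≤ (Γ₅D_W(m))² + c·1` (difference `m (D_W(0) + D_W(0)ᴴ) ≥ 0`). [Montvay–Münster 1994 §7.4] -/
theorem massWide_sq_massZero_le_sq (U : GaugeConfig 4 L SU3) {m : ℝ} (hm : 0 ≤ m) (c : ℝ) :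
    (spinorLift gammaFive * wilsonDirac (fundamentalRep (Fin 3)) U 0 1) *
          (spinorLift gammaFive * wilsonDirac (fundamentalRep (Fin 3)) U 0 1) +
        (((m ^ 2 + c : ℝ)) : ℂ) • (1 : Matrix (QuarkIdx L) (QuarkIdx L) ℂ) ≤
      (spinorLift gammaFive * wilsonDirac (fundamentalRep (Fin 3)) U m 1) *
          (spinorLift gammaFive * wilsonDirac (fundamentalRep (Fin 3)) U m 1) +
        ((c : ℝ) : ℂ) • (1 : Matrix (QuarkIdx L) (QuarkIdx L) ℂ) := by
  rw [Matrix.le_iff, massWide_hermitianWilson_mul_self, massWide_hermitianWilson_mul_self]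
  set D : Matrix (QuarkIdx L) (QuarkIdx L) ℂ := wilsonDirac (fundamentalRep (Fin 3)) U 0 1 with hD
  have hDm : wilsonDirac (fundamentalRep (Fin 3)) U m 1 = D + ((m : ℝ) : ℂ) • (1 : Matrix (QuarkIdx L) (QuarkIdx L) ℂ) := by
    have h := wilsonDirac_add_mass (fundamentalRep (Fin 3)) U 0 m 1
    rw [zero_add] at h
    exact h
  have key : (D + ((m : ℝ) : ℂ) • (1 : Matrix (QuarkIdx L) (QuarkIdx L) ℂ))ᴴ *
        (D + ((m : ℝ) : ℂ) • (1 : Matrix (QuarkIdx L) (QuarkIdx L) ℂ)) +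
        ((c : ℝ) : ℂ) • (1 : Matrix (QuarkIdx L) (QuarkIdx L) ℂ) -
      (Dᴴ * D + (((m ^ 2 + c : ℝ)) : ℂ) • (1 : Matrix (QuarkIdx L) (QuarkIdx L) ℂ)) =
      ((m : ℝ) : ℂ) • (D + Dᴴ) := by
    have hstar : star ((m : ℝ) : ℂ) = ((m : ℝ) : ℂ) := by
      rw [Complex.star_def, Complex.conj_ofReal]
    ext i j
    simp only [conjTranspose_add, conjTranspose_smul, conjTranspose_one, hstar, Matrix.add_mul, Matrix.mul_add, Matrix.smul_mul, Matrix.mul_smul,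
      Matrix.one_mul, Matrix.mul_one, Matrix.add_apply, Matrix.sub_apply, Matrix.smul_apply,
      Matrix.one_apply, smul_eq_mul]
    push_cast
    split_ifs <;> ring
  rw [hDm, key]
  -- `D + Dᴴ ⪰ 0` (Wilson positivity; = the landed `ChessboardColdCells.posSemidef_add_conjTranspose_wilsonDirac`,
  -- whose module has no hub olean today, hence re-derived from `stub_positivity` in three lines)
  have hpsd : (D + Dᴴ).PosSemidef := by
    refine Matrix.PosSemidef.of_dotProduct_mulVec_nonneg ?_ fun v => ?_
    · show (D + Dᴴ)ᴴ = D + Dᴴ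
      rw [conjTranspose_add, conjTranspose_conjTranspose, add_comm]
    · have hre : 0 ≤ (star v ⬝ᵥ D *ᵥ v).re := by rw [stub_positivity L U v]; positivity
      have hconj : star v ⬝ᵥ Dᴴ *ᵥ v = (starRingEnd ℂ) (star v ⬝ᵥ D *ᵥ v) := by
        rw [mulVec_conjTranspose, star_dotProduct_star, ← dotProduct_mulVec, Complex.star_def]
      rw [add_mulVec, dotProduct_add, hconj, Complex.add_conj]
      exact Complex.zero_le_real.mpr (by linarith)
  exact hpsd.smul (Complex.zero_le_real.mpr hm)

/-- **Pointwise mass monotonicity of the local resolvent trace**: for every torus, site, `SU(3)` gauge field `W`,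
`m₀ ≥ 0`, `ε > 0`: `t_x(W; m₀, ε) ≤ t_x(W; 0, √(m₀²+ε²))`. [Wegner 1981; Montvay–Münster 1994 §7.4] -/
theorem localTrace_le_massZero (x : TorusSite 4 L) (W : GaugeConfig 4 L SU3) {m₀ ε : ℝ}
    (hm : 0 ≤ m₀) (hε : 0 < ε) :
    (∑ a : Fin 3, ∑ α : Fin 4,
          (((spinorLift gammaFive * wilsonDirac (fundamentalRep (Fin 3))
              W m₀ 1 -
            ((ε : ℂ) * Complex.I) • (1 : Matrix (QuarkIdx L) (QuarkIdx L) ℂ))⁻¹ :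
              Matrix (QuarkIdx L) (QuarkIdx L) ℂ) (x, a, α) (x, a, α)).im) ≤
      (∑ a : Fin 3, ∑ α : Fin 4,
          (((spinorLift gammaFive * wilsonDirac (fundamentalRep (Fin 3))
              W 0 1 -
            (((Real.sqrt (m₀ ^ 2 + ε ^ 2)) : ℂ) * Complex.I) • (1 : Matrix (QuarkIdx L) (QuarkIdx L) ℂ))⁻¹ :
              Matrix (QuarkIdx L) (QuarkIdx L) ℂ) (x, a, α) (x, a, α)).im) := by
  set ε' : ℝ := Real.sqrt (m₀ ^ 2 + ε ^ 2) with hε'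
  have hε'sq : ε' ^ 2 = m₀ ^ 2 + ε ^ 2 := Real.sq_sqrt (by positivity)
  have hεε' : ε ≤ ε' := Real.le_sqrt_of_sq_le (by nlinarith [sq_nonneg m₀])
  have hε'pos : 0 < ε' := lt_of_lt_of_le hε hεε'
  have hHm := isHermitian_gammaFive_mul_wilsonDirac (fundamentalRep (Fin 3)) fundamentalRep_mem_unitaryGroup W m₀ 1
  have hH0 := isHermitian_gammaFive_mul_wilsonDirac (fundamentalRep (Fin 3)) fundamentalRep_mem_unitaryGroup W 0 1
  set Hm : Matrix (QuarkIdx L) (QuarkIdx L) ℂ := spinorLift gammaFive * wilsonDirac (fundamentalRep (Fin 3)) W m₀ 1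
    with hHmdef
  set H0 : Matrix (QuarkIdx L) (QuarkIdx L) ℂ := spinorLift gammaFive * wilsonDirac (fundamentalRep (Fin 3)) W 0 1
    with hH0def
  have hQ0 : (H0 * H0 + (((ε' ^ 2 : ℝ)) : ℂ) • (1 : Matrix (QuarkIdx L) (QuarkIdx L) ℂ)).PosDef :=
    massWide_posDef_mul_self_add hH0 (by positivity)
  have hle : H0 * H0 + (((ε' ^ 2 : ℝ)) : ℂ) • (1 : Matrix (QuarkIdx L) (QuarkIdx L) ℂ) ≤
      Hm * Hm + (((ε ^ 2 : ℝ)) : ℂ) • (1 : Matrix (QuarkIdx L) (QuarkIdx L) ℂ) := by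
    rw [hε'sq]
    exact massWide_sq_massZero_le_sq W hm (ε ^ 2)
  have hinvle := massWide_inv_antitone hQ0 hle
  refine Finset.sum_le_sum fun a _ => Finset.sum_le_sum fun α _ => ?_
  rw [massWide_im_resolvent_apply_self hHm hε, massWide_im_resolvent_apply_self hH0 hε'pos]
  have h1 := massWide_re_apply_self_le_of_le hinvle (x, a, α)
  have h2 := massWide_re_inv_apply_self_nonneg hQ0 (x, a, α)
  exact (mul_le_mul_of_nonneg_left h1 hε.le).trans (mul_le_mul_of_nonneg_right hεε' h2)

/-- Continuity in the gauge field of the site-local resolvent trace (`ε > 0`; the shifted Hermitian Wilson operator is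
polynomial in the links and everywhere invertible). Re-proved slice of the landed `stub_localTraceRegular` (p88424). -/
theorem massWide_localTrace_continuous (x : TorusSite 4 L) (m₀ ε : ℝ) (hε : 0 < ε) :
    Continuous fun U : GaugeConfig 4 L SU3 =>
      ∑ a : Fin 3, ∑ α : Fin 4,
        (((spinorLift gammaFive * wilsonDirac (fundamentalRep (Fin 3)) U m₀ 1 -
          ((ε : ℂ) * Complex.I) • (1 : Matrix (QuarkIdx L) (QuarkIdx L) ℂ))⁻¹ :
            Matrix (QuarkIdx L) (QuarkIdx L) ℂ) (x, a, α) (x, a, α)).im := by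
  have hHerm : ∀ U : GaugeConfig 4 L SU3,
      (spinorLift gammaFive * wilsonDirac (fundamentalRep (Fin 3)) U m₀ 1).IsHermitian := fun U =>
    isHermitian_gammaFive_mul_wilsonDirac (fundamentalRep (Fin 3)) fundamentalRep_mem_unitaryGroup U m₀ 1
  have hB : Continuous fun U : GaugeConfig 4 L SU3 =>
      spinorLift gammaFive * wilsonDirac (fundamentalRep (Fin 3)) U m₀ 1 -
        ((ε : ℂ) * Complex.I) • (1 : Matrix (QuarkIdx L) (QuarkIdx L) ℂ) :=
    (continuous_const.mul (continuous_wilsonDirac (fundamentalRep (Fin 3))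
      (continuous_fundamentalRep (Fin 3)) m₀ 1)).sub continuous_const
  have hR : Continuous fun U : GaugeConfig 4 L SU3 =>
      (spinorLift gammaFive * wilsonDirac (fundamentalRep (Fin 3)) U m₀ 1 -
        ((ε : ℂ) * Complex.I) • (1 : Matrix (QuarkIdx L) (QuarkIdx L) ℂ))⁻¹ :=
    continuous_iff_continuousAt.2 fun U =>
      (continuousAt_matrix_inv _ (by
        rw [Ring.inverse_eq_inv']
        exact continuousAt_inv₀ (massWide_det_resolvent_ne_zero (hHerm U) hε))).comp hB.continuousAt
  exact continuous_finsetSum _ fun a _ => continuous_finsetSum _ fun α _ =>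
    Complex.continuous_im.comp (hR.matrix_elem _ _)

/-- The site-local resolvent trace lies in `[0, 12/ε]` (twelve diagonal entries, each in `[0, 1/ε]`); slice of p88424. -/
theorem massWide_localTrace_mem (x : TorusSite 4 L) (m₀ ε : ℝ) (hε : 0 < ε) (U : GaugeConfig 4 L SU3) :
    (∑ a : Fin 3, ∑ α : Fin 4,
        (((spinorLift gammaFive * wilsonDirac (fundamentalRep (Fin 3)) U m₀ 1 -
          ((ε : ℂ) * Complex.I) • (1 : Matrix (QuarkIdx L) (QuarkIdx L) ℂ))⁻¹ :
            Matrix (QuarkIdx L) (QuarkIdx L) ℂ) (x, a, α) (x, a, α)).im) ∈ Set.Icc 0 (12 / ε) := by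
  have hHerm : (spinorLift gammaFive * wilsonDirac (fundamentalRep (Fin 3)) U m₀ 1).IsHermitian :=
    isHermitian_gammaFive_mul_wilsonDirac (fundamentalRep (Fin 3)) fundamentalRep_mem_unitaryGroup U m₀ 1
  have h := fun (a : Fin 3) (α : Fin 4) => massWide_im_resolvent_apply_self_mem hHerm hε (x, a, α)
  constructor
  · exact Finset.sum_nonneg fun a _ => Finset.sum_nonneg fun α _ => (h a α).1
  · refine (Finset.sum_le_sum fun a _ => Finset.sum_le_sum fun α _ => (h a α).2).trans (le_of_eq ?_)
    simp only [Finset.sum_const, Finset.card_univ, Fintype.card_fin]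
    ring

end Wilson

/-- **W on `[−1,1]` from W on `[−1,0]`** (same `R, L₀, θ`; constant `C + 12`): for `m₀ > 0` bound the integrand by its
value at mass `0` and scale `ε′ = √(m₀²+ε²) ≥ ε` (`localTrace_le_massZero`), then use the hypothesis at `(0, ε′)` if
`ε′ ≤ 1` (`ε′^{−θ} ≤ ε^{−θ}`) and `t_x ≤ 12/ε′ < 12 ≤ 12 ε^{−θ}` if `ε′ > 1`. -/
theorem stub_localHaarWegnerWide_of_nonposMass
    (hloc : (∃ R L₀ : ℕ, ∃ C θ : ℝ, 0 < C ∧ 0 ≤ θ ∧ θ < 1 ∧ ∀ (L : ℕ) [NeZero L], L₀ ≤ L →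
      ∀ (x : TorusSite 4 L) (m₀ ε : ℝ), -1 ≤ m₀ → m₀ ≤ 0 → 0 < ε → ε ≤ 1 →
      ∀ U : GaugeConfig 4 L SU3,
        ∫ V, (∑ a : Fin 3, ∑ α : Fin 4,
          (((spinorLift gammaFive * wilsonDirac (fundamentalRep (Fin 3))
              (fun e => if (∃ y ∈ box 4 R, e.1 = x + Torus.proj L y) then V e else U e) m₀ 1 -
            ((ε : ℂ) * Complex.I) • (1 : Matrix (QuarkIdx L) (QuarkIdx L) ℂ))⁻¹ :
              Matrix (QuarkIdx L) (QuarkIdx L) ℂ) (x, a, α) (x, a, α)).im)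
          ∂(Measure.pi fun _ : Edge 4 L => haarProbability SU3) ≤ C * ε ^ (-θ))) :
    (∃ R L₀ : ℕ, ∃ C θ : ℝ, 0 < C ∧ 0 ≤ θ ∧ θ < 1 ∧ ∀ (L : ℕ) [NeZero L], L₀ ≤ L →
      ∀ (x : TorusSite 4 L) (m₀ ε : ℝ), -1 ≤ m₀ → m₀ ≤ 1 → 0 < ε → ε ≤ 1 →
      ∀ U : GaugeConfig 4 L SU3,
        ∫ V, (∑ a : Fin 3, ∑ α : Fin 4,
          (((spinorLift gammaFive * wilsonDirac (fundamentalRep (Fin 3))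
              (fun e => if (∃ y ∈ box 4 R, e.1 = x + Torus.proj L y) then V e else U e) m₀ 1 -
            ((ε : ℂ) * Complex.I) • (1 : Matrix (QuarkIdx L) (QuarkIdx L) ℂ))⁻¹ :
              Matrix (QuarkIdx L) (QuarkIdx L) ℂ) (x, a, α) (x, a, α)).im)
          ∂(Measure.pi fun _ : Edge 4 L => haarProbability SU3) ≤ C * ε ^ (-θ)) := by
  obtain ⟨R, L₀, C, θ, hC, hθ0, hθ1, hloc⟩ := hloc
  refine ⟨R, L₀, C + 12, θ, by linarith, hθ0, hθ1, ?_⟩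
  intro L _ hL x m₀ ε hm1 hm2 hε hε1 U
  have hεθ : 1 ≤ ε ^ (-θ) := Real.one_le_rpow_of_pos_of_le_one_of_nonpos hε hε1 (by linarith)
  rcases le_or_gt m₀ 0 with hm0 | hm0
  · calc _ ≤ C * ε ^ (-θ) := hloc L hL x m₀ ε hm1 hm0 hε hε1 U
      _ ≤ (C + 12) * ε ^ (-θ) := by nlinarith [hεθ]
  · -- positive bare mass: compare with mass `0` at scale `ε' = √(m₀² + ε²)`
    set ε' : ℝ := Real.sqrt (m₀ ^ 2 + ε ^ 2) with hε'
    have hεε' : ε ≤ ε' := Real.le_sqrt_of_sq_le (by nlinarith [sq_nonneg m₀])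
    have hε'pos : 0 < ε' := lt_of_lt_of_le hε hεε'
    set gl : GaugeConfig 4 L SU3 → GaugeConfig 4 L SU3 := fun V =>
      (fun e => if (∃ y ∈ box 4 R, e.1 = x + Torus.proj L y) then V e else U e) with hgl
    have hglc : Continuous gl := continuous_pi fun e => by
      by_cases h : ∃ y ∈ box 4 R, e.1 = x + Torus.proj L y
      · simpa only [hgl, if_pos h] using continuous_apply e
      · simpa only [hgl, if_neg h] using continuous_const
    set f : GaugeConfig 4 L SU3 → ℝ := fun W =>
      (∑ a : Fin 3, ∑ α : Fin 4,
          (((spinorLift gammaFive * wilsonDirac (fundamentalRep (Fin 3))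
              W m₀ 1 -
            ((ε : ℂ) * Complex.I) • (1 : Matrix (QuarkIdx L) (QuarkIdx L) ℂ))⁻¹ :
              Matrix (QuarkIdx L) (QuarkIdx L) ℂ) (x, a, α) (x, a, α)).im) with hf
    set g : GaugeConfig 4 L SU3 → ℝ := fun W =>
      (∑ a : Fin 3, ∑ α : Fin 4,
          (((spinorLift gammaFive * wilsonDirac (fundamentalRep (Fin 3))
              W 0 1 -
            (((Real.sqrt (m₀ ^ 2 + ε ^ 2)) : ℂ) * Complex.I) • (1 : Matrix (QuarkIdx L) (QuarkIdx L) ℂ))⁻¹ :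
              Matrix (QuarkIdx L) (QuarkIdx L) ℂ) (x, a, α) (x, a, α)).im) with hg
    have hfb := massWide_localTrace_mem x m₀ ε hε
    have hgc := massWide_localTrace_continuous (L := L) x 0 ε' hε'pos
    have hgb := massWide_localTrace_mem x 0 ε' hε'pos
    have hpt : ∀ V, f (gl V) ≤ g (gl V) := fun V => localTrace_le_massZero x (gl V) hm0.le hε
    have hgint : Integrable (fun V => g (gl V)) (Measure.pi fun _ : Edge 4 L => haarProbability SU3) :=
      (hgc.comp hglc).integrable_of_hasCompactSupport (HasCompactSupport.of_compactSpace _)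
    have step1 : ∫ V, f (gl V) ∂(Measure.pi fun _ : Edge 4 L => haarProbability SU3) ≤ ∫ V, g (gl V) ∂(Measure.pi fun _ : Edge 4 L => haarProbability SU3) :=
      integral_mono_of_nonneg (ae_of_all _ fun V => (hfb (gl V)).1) hgint (ae_of_all _ hpt)
    show ∫ V, f (gl V) ∂(Measure.pi fun _ : Edge 4 L => haarProbability SU3) ≤ (C + 12) * ε ^ (-θ)
    rcases le_or_gt ε' 1 with hε'1 | hε'1
    · have h2 : ∫ V, g (gl V) ∂(Measure.pi fun _ : Edge 4 L => haarProbability SU3) ≤ C * ε' ^ (-θ) := hloc L hL x 0 ε' (by norm_num) le_rfl hε'pos hε'1 U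
      have h4 : C * ε' ^ (-θ) ≤ C * ε ^ (-θ) :=
        mul_le_mul_of_nonneg_left (Real.rpow_le_rpow_of_nonpos hε hεε' (by linarith)) hC.le
      nlinarith [step1, h2, h4, hεθ]
    · have step2 : ∫ V, g (gl V) ∂(Measure.pi fun _ : Edge 4 L => haarProbability SU3) ≤ ∫ _V, (12 / ε' : ℝ) ∂(Measure.pi fun _ : Edge 4 L => haarProbability SU3) :=
        integral_mono hgint (integrable_const _) fun V => (hgb (gl V)).2
      have step3 : ∫ _V, (12 / ε' : ℝ) ∂(Measure.pi fun _ : Edge 4 L => haarProbability SU3) = 12 / ε' := by simp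
      have h12 : 12 / ε' ≤ 12 := div_le_self (by norm_num) hε'1.le
      nlinarith [step1, step2, step3, h12, hεθ, mul_nonneg hC.le (le_trans zero_le_one hεθ)]

/-- **W ⇐ 8966's Hölder local Haar–Wegner lemma, verbatim**: the registered stub W `stub_localHaarWegnerWide`
(masses `[−1,1]`, tori `L ≥ L₀`) follows from VERBATIM the hypothesis `hloc` of the landed
`WegnerEstimate.ResolventCell.wegnerEstimateHolder_of_localHaarWegnerHolder` (stmt-QuantumFields-8966, Hölder branch:
masses `[−1,0]`, tori `L ≥ 2`), with `L₀ := 2`, constant `C + 12`. -/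
theorem stub_localHaarWegnerWide_of_localHaarWegnerHolder
    (hloc : (∃ R : ℕ, ∃ C θ : ℝ, 0 < C ∧ 0 ≤ θ ∧ θ < 1 ∧ ∀ (L : ℕ) [NeZero L], 2 ≤ L →
      ∀ (x : TorusSite 4 L) (m₀ ε : ℝ), -1 ≤ m₀ → m₀ ≤ 0 → 0 < ε → ε ≤ 1 →
      ∀ U : GaugeConfig 4 L SU3,
        ∫ V, (∑ a : Fin 3, ∑ α : Fin 4,
          (((spinorLift gammaFive * wilsonDirac (fundamentalRep (Fin 3))
              (fun e => if (∃ y ∈ box 4 R, e.1 = x + Torus.proj L y) then V e else U e) m₀ 1 -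
            ((ε : ℂ) * Complex.I) • (1 : Matrix (QuarkIdx L) (QuarkIdx L) ℂ))⁻¹ :
              Matrix (QuarkIdx L) (QuarkIdx L) ℂ) (x, a, α) (x, a, α)).im)
          ∂(Measure.pi fun _ : Edge 4 L => haarProbability SU3) ≤ C * ε ^ (-θ))) :
    (∃ R L₀ : ℕ, ∃ C θ : ℝ, 0 < C ∧ 0 ≤ θ ∧ θ < 1 ∧ ∀ (L : ℕ) [NeZero L], L₀ ≤ L →
      ∀ (x : TorusSite 4 L) (m₀ ε : ℝ), -1 ≤ m₀ → m₀ ≤ 1 → 0 < ε → ε ≤ 1 →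
      ∀ U : GaugeConfig 4 L SU3,
        ∫ V, (∑ a : Fin 3, ∑ α : Fin 4,
          (((spinorLift gammaFive * wilsonDirac (fundamentalRep (Fin 3))
              (fun e => if (∃ y ∈ box 4 R, e.1 = x + Torus.proj L y) then V e else U e) m₀ 1 -
            ((ε : ℂ) * Complex.I) • (1 : Matrix (QuarkIdx L) (QuarkIdx L) ℂ))⁻¹ :
              Matrix (QuarkIdx L) (QuarkIdx L) ℂ) (x, a, α) (x, a, α)).im)
          ∂(Measure.pi fun _ : Edge 4 L => haarProbability SU3) ≤ C * ε ^ (-θ)) := by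
  obtain ⟨R, C, θ, hC, hθ0, hθ1, hloc⟩ := hloc
  exact stub_localHaarWegnerWide_of_nonposMass ⟨R, 2, C, θ, hC, hθ0, hθ1, hloc⟩

end Summit.QuantumFields.QCD.Cruxes.ExtinctionBuildsQCD.DeterminantTilt

end
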